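import Literature.MathematicalPhysics.KineticTheory.SdeGeneratorCalculus
import Mathlib.Analysis.SpecialFunctions.Arsinh
import Mathlib.Analysis.SpecialFunctions.Trigonometric.ArctanDeriv
import HarnessLib

/-!
# One-variable profiles for the Fokker–Planck identification of site-inhomogeneous chains

Topic `Literature/MathematicalPhysics/KineticTheory`, grouping namespace `…KineticTheory.HeatConduction`.
Model-free calculus used by the `L¹` Fokker–Planck argument "weakly stationary smooth density ⇒
invariant measure" for Langevin chains (Cuneo–Eckmann–Hairer–Rey-Bellet 2018 §3.1; files
`SiteChainFokkerPlanck*.lean`), where a `C²` solution `ρ ≥ 0` of `L̂ρ + 2γρ = 0` is approximated by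
the compactly supported truncations `χ(H/R) · m_M(ρ)`:

* the smooth cutoff `χ = smoothCutoff` (`LangevinChainExpBound.lean`): joint global bounds on
  `χ'`, `χ''`, their vanishing off `[1, 2]`, and the scaled profiles `h ↦ χ'(h/R)/R`;
* the **height truncation** `m_M(s) = M φ(s/M)` (`φ = linCutoff`, the primitive of `χ`;
  `LangevinChainLyapunovDrift.lean`): `C²`, `m_M(s) = s` for `s ≤ M`, `0 ≤ m_M(s) ≤ s` and
  `0 ≤ m_M(s) - s m_M'(s) ≤ θ_M(s) := s [M < s]` on `s ≥ 0`;
* the **Fisher profile package** `exists_fisherProfile`: for `δ > 0` and `S₀` a convex `C²`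
  profile `F` (namely `F(s) = ∫₀ˢ arctan(arsinh(σ/δ)) dσ`) with `0 ≤ F ≤ (π/2) s`,
  `0 ≤ sF' - F ≤ (π/2) s` on `s ≥ 0`, `F'' > 0`, and `1/F''(s) ≤ (1 + arsinh²(S₀/δ))(s + δ)` on
  `[0, S₀]` — bounded slope bought with a `log²` loss in the curvature, the profile behind the
  weighted Fisher-information bound;
* the AM–GM step `|y| ≤ ½ (εK + c y²/ε)` whenever `1/c ≤ K`, and `C²` compositions
  `F ∘ g` from two derivatives of `F`.

## References

* N. Cuneo, J.-P. Eckmann, M. Hairer, L. Rey-Bellet, Electron. J. Probab. **23** (2018) no. 55, §3.1.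
* D. Bakry, I. Gentil, M. Ledoux, *Analysis and Geometry of Markov Diffusion Operators* (2014),
  §1.4.2 (carré du champ), §5 (entropy / Fisher information along a diffusion).

## Design choices

* No definitions: the profiles are written as explicit terms (`M * linCutoff (s / M)`) or packaged
  existentially (`exists_fisherProfile`), so that consumers never unfold.
* NOT here: anything about chains (`SiteChainFokkerPlanckCutoff.lean` onwards).
-/

noncomputable section

open MeasureTheory Filter Topology Set
open scoped ContDiff

namespace Literature.MathematicalPhysics.KineticTheory.HeatConduction

open Literature.MathematicalPhysics.KineticTheory

/-! ### The smooth cutoff: derivatives -/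

/-- `χ' = 0` off `[1, 2]`, open form: `χ'(u) = 0` for `u < 1` or `u > 2`. [folklore] -/
theorem deriv_smoothCutoff_eq_zero_of_lt_or_lt {u : ℝ} (hu : u < 1 ∨ 2 < u) : deriv smoothCutoff u = 0 := by
  rcases hu with hu | hu
  · have h : smoothCutoff =ᶠ[𝓝 u] fun _ => (1:ℝ) := by
      filter_upwards [Iio_mem_nhds hu] with v hv
      exact smoothCutoff_of_le_one (le_of_lt hv)
    rw [h.deriv_eq, deriv_const]
  · have h : smoothCutoff =ᶠ[𝓝 u] fun _ => (0:ℝ) := by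
      filter_upwards [Ioi_mem_nhds hu] with v hv
      exact smoothCutoff_of_two_le (le_of_lt hv)
    rw [h.deriv_eq, deriv_const]

/-- `χ'' = 0` off `[1, 2]`: `χ''(u) = 0` for `u < 1` or `u > 2`. [folklore] -/
theorem deriv_deriv_smoothCutoff_eq_zero_of_lt_or_lt {u : ℝ} (hu : u < 1 ∨ 2 < u) :
    deriv (deriv smoothCutoff) u = 0 := by
  have hopen : (Iio (1:ℝ) ∪ Ioi 2) ∈ 𝓝 u := by
    rcases hu with hu | hu
    · exact (isOpen_Iio.union isOpen_Ioi).mem_nhds (Or.inl hu)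
    · exact (isOpen_Iio.union isOpen_Ioi).mem_nhds (Or.inr hu)
  have h : deriv smoothCutoff =ᶠ[𝓝 u] fun _ => (0 : ℝ) := by
    filter_upwards [hopen] with w hw
    rcases hw with hw | hw
    · exact deriv_smoothCutoff_eq_zero_of_lt_or_lt (Or.inl hw)
    · exact deriv_smoothCutoff_eq_zero_of_lt_or_lt (Or.inr hw)
  rw [h.deriv_eq, deriv_const]

/-- **`χ'` and `χ''` are globally bounded** (both are continuous and vanish off `[1, 2]`): one
constant `M ≥ 0` with `|χ'| ≤ M` and `|χ''| ≤ M`. [folklore] -/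
theorem exists_bound_derivs_smoothCutoff :
    ∃ M : ℝ, 0 ≤ M ∧ (∀ u, |deriv smoothCutoff u| ≤ M) ∧ ∀ u, |deriv (deriv smoothCutoff) u| ≤ M := by
  have hsupp : HasCompactSupport (deriv smoothCutoff) :=
    HasCompactSupport.intro isCompact_Icc fun u hu => by
      rw [mem_Icc, not_and_or, not_le, not_le] at hu
      exact deriv_smoothCutoff_eq_zero_of_lt_or_lt hu
  have hc1 : Continuous (deriv smoothCutoff) := (contDiff_smoothCutoff (n := 1)).continuous_deriv le_rfl
  have h1 : ContDiff ℝ 1 (deriv smoothCutoff) := (contDiff_smoothCutoff (n := 2)).deriv'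
  have hc2 : Continuous (deriv (deriv smoothCutoff)) := h1.continuous_deriv le_rfl
  obtain ⟨C₁, hC₁⟩ := hc1.bounded_above_of_compact_support hsupp
  obtain ⟨C₂, hC₂⟩ := hc2.bounded_above_of_compact_support hsupp.deriv
  refine ⟨max (max C₁ C₂) 0, le_max_right _ _, fun u => ?_, fun u => ?_⟩
  · have := hC₁ u
    rw [Real.norm_eq_abs] at this
    exact this.trans ((le_max_left _ _).trans (le_max_left _ _))
  · have := hC₂ u
    rw [Real.norm_eq_abs] at this
    exact this.trans ((le_max_right _ _).trans (le_max_left _ _))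

/-- The scaled slope `h ↦ χ'(h/R)/R` has derivative `χ''(h/R)/R/R`. [folklore] -/
theorem hasDerivAt_deriv_scaled_smoothCutoff (R u : ℝ) :
    HasDerivAt (fun h => deriv smoothCutoff (h / R) / R) (deriv (deriv smoothCutoff) (u / R) / R / R) u := by
  have hid : HasDerivAt (fun h : ℝ => h / R) (1 / R) u := by simpa using (hasDerivAt_id u).div_const R
  have hd : HasDerivAt (deriv smoothCutoff) (deriv (deriv smoothCutoff) (u / R)) (u / R) :=
    (((contDiff_smoothCutoff (n := 2)).deriv' (n := 1)).differentiable one_ne_zero _).hasDerivAt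
  have := (hd.comp u hid).div_const R
  simp only [Function.comp_def] at this
  exact this.congr_deriv (by ring)

/-- Off the energy shell `R ≤ h ≤ 2R` the slope `χ'(h/R)` vanishes (`R > 0`). [folklore] -/
theorem deriv_smoothCutoff_div_eq_zero_of_not_shell {R h : ℝ} (hR : 0 < R) (hh : ¬ (R ≤ h ∧ h ≤ 2 * R)) :
    deriv smoothCutoff (h / R) = 0 := by
  refine deriv_smoothCutoff_eq_zero_of_lt_or_lt ?_
  rcases not_and_or.1 hh with hh | hh
  · exact Or.inl ((div_lt_one hR).2 (not_le.1 hh))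
  · exact Or.inr ((lt_div_iff₀ hR).2 (by linarith [not_le.1 hh]))

/-- Off the energy shell `R ≤ h ≤ 2R` the curvature `χ''(h/R)` vanishes (`R > 0`). [folklore] -/
theorem deriv_deriv_smoothCutoff_div_eq_zero_of_not_shell {R h : ℝ} (hR : 0 < R)
    (hh : ¬ (R ≤ h ∧ h ≤ 2 * R)) : deriv (deriv smoothCutoff) (h / R) = 0 := by
  refine deriv_deriv_smoothCutoff_eq_zero_of_lt_or_lt ?_
  rcases not_and_or.1 hh with hh | hh
  · exact Or.inl ((div_lt_one hR).2 (not_le.1 hh))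
  · exact Or.inr ((lt_div_iff₀ hR).2 (by linarith [not_le.1 hh]))

/-! ### `C²` compositions from two derivatives -/

/-- A real profile `F` with a derivative `F'` which has a continuous derivative `F''` composes
with `C²` functions to `C²` functions. [folklore] -/
theorem contDiff_two_comp_of_hasDerivAt {E : Type*} [NormedAddCommGroup E] [NormedSpace ℝ E]
    {F F' F'' : ℝ → ℝ} (hF : ∀ u, HasDerivAt F (F' u) u) (hF' : ∀ u, HasDerivAt F' (F'' u) u)
    (hF'' : Continuous F'') {g : E → ℝ} (hg : ContDiff ℝ 2 g) : ContDiff ℝ 2 fun x => F (g x) := by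
  have hd : deriv F = F' := funext fun u => (hF u).deriv
  have hd' : deriv F' = F'' := funext fun u => (hF' u).deriv
  have h1 : ContDiff ℝ 1 F' := by
    rw [show (1 : WithTop ℕ∞) = 0 + 1 from rfl, contDiff_succ_iff_deriv]
    exact ⟨fun u => (hF' u).differentiableAt, fun h => absurd h (by simp), by
      rw [hd']; exact contDiff_zero.2 hF''⟩
  have h2 : ContDiff ℝ 2 F := by
    rw [show (2 : WithTop ℕ∞) = 1 + 1 from rfl, contDiff_succ_iff_deriv]
    exact ⟨fun u => (hF u).differentiableAt, fun h => absurd h (by simp), by rwa [hd]⟩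
  exact h2.comp hg

/-! ### The height truncation `m_M(s) = M φ(s/M)` -/

section Height

/-- The height truncation is `C²`. [folklore] -/
theorem contDiff_two_heightCutoff (M : ℝ) : ContDiff ℝ 2 fun s : ℝ => M * linCutoff (s / M) :=
  contDiff_const.mul (contDiff_two_linCutoff.comp (contDiff_id.div_const M))

/-- `x χ(x) ≤ φ(x)` for `x ≥ 0` (`χ` is antitone, `φ(x) = ∫₀ˣ χ`). [folklore] -/
theorem mul_smoothCutoff_le_linCutoff {x : ℝ} (hx : 0 ≤ x) : x * smoothCutoff x ≤ linCutoff x := by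
  unfold linCutoff
  have h : ∫ _ in (0:ℝ)..x, smoothCutoff x ≤ ∫ s in (0:ℝ)..x, smoothCutoff s :=
    intervalIntegral.integral_mono_on hx intervalIntegrable_const
      (continuous_smoothCutoff.intervalIntegrable _ _) fun s hs => antitone_smoothCutoff hs.2
  rw [intervalIntegral.integral_const, smul_eq_mul, sub_zero] at h
  linarith

variable {M : ℝ} (hM : 0 < M)
include hM

/-- `m_M(s) = s` for `s ≤ M`. [folklore] -/
theorem heightCutoff_eq_self {s : ℝ} (hs : s ≤ M) : M * linCutoff (s / M) = s := by
  rw [linCutoff_of_le_one ((div_le_one hM).2 hs)]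
  field_simp

/-- `0 ≤ m_M(s) ≤ s` for `s ≥ 0`. [folklore] -/
theorem heightCutoff_mem_Icc {s : ℝ} (hs : 0 ≤ s) : M * linCutoff (s / M) ∈ Icc (0 : ℝ) s := by
  have hsM : 0 ≤ s / M := div_nonneg hs hM.le
  refine ⟨mul_nonneg hM.le (linCutoff_nonneg hsM), ?_⟩
  calc M * linCutoff (s / M) ≤ M * (s / M) := mul_le_mul_of_nonneg_left (linCutoff_le_self hsM) hM.le
    _ = s := by field_simp

/-- `s m_M'(s) ≤ m_M(s)` for `s ≥ 0` (concavity). [folklore] -/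
theorem mul_deriv_le_heightCutoff {s : ℝ} (hs : 0 ≤ s) :
    s * smoothCutoff (s / M) ≤ M * linCutoff (s / M) := by
  have h := mul_smoothCutoff_le_linCutoff (div_nonneg hs hM.le : 0 ≤ s / M)
  have := mul_le_mul_of_nonneg_left h hM.le
  calc s * smoothCutoff (s / M) = M * (s / M * smoothCutoff (s / M)) := by field_simp
    _ ≤ M * linCutoff (s / M) := this

/-- `m_M'(s) = χ(s/M) = 0` for `s ≥ 2M`. [folklore] -/
theorem smoothCutoff_div_eq_zero_of_two_mul_le {s : ℝ} (hs : 2 * M ≤ s) : smoothCutoff (s / M) = 0 :=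
  smoothCutoff_of_two_le ((le_div_iff₀ hM).2 hs)

/-- `m_M''(s) = χ'(s/M)/M ≤ 0`. [folklore] -/
theorem deriv_smoothCutoff_div_nonpos (s : ℝ) : deriv smoothCutoff (s / M) / M ≤ 0 :=
  div_nonpos_of_nonpos_of_nonneg (deriv_smoothCutoff_nonpos _) hM.le

/-- **The profile `s - m_M(s)` of the height truncation**: on `s ≥ 0`, with `θ_M(s) = s·[M < s]`,
`0 ≤ s - m_M(s) ≤ θ_M(s)` and `0 ≤ s (1 - m_M'(s)) - (s - m_M(s)) ≤ θ_M(s)` (all four vanish on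
`[0, M]`). [folklore] -/
theorem sub_heightCutoff_bounds {s : ℝ} (hs : 0 ≤ s) :
    0 ≤ s - M * linCutoff (s / M) ∧
    s - M * linCutoff (s / M) ≤ 1 * (if M < s then s else 0) ∧
    0 ≤ s * (1 - smoothCutoff (s / M)) - (s - M * linCutoff (s / M)) ∧
    s * (1 - smoothCutoff (s / M)) - (s - M * linCutoff (s / M)) ≤ 1 * (if M < s then s else 0) := by
  have h1 := heightCutoff_mem_Icc hM hs
  have h2 := mul_deriv_le_heightCutoff hM hs
  refine ⟨by linarith [h1.2], ?_, by nlinarith [h2], ?_⟩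
  · split_ifs with h
    · linarith [h1.1]
    · rw [heightCutoff_eq_self hM (not_lt.1 h)]; simp
  · split_ifs with h
    · have : 0 ≤ s * smoothCutoff (s / M) := mul_nonneg hs (smoothCutoff_nonneg _)
      nlinarith [h1.2]
    · rw [heightCutoff_eq_self hM (not_lt.1 h), smoothCutoff_of_le_one ((div_le_one hM).2 (not_lt.1 h))]
      simp

end Height

/-! ### The Fisher profile `F_δ(s) = ∫₀ˢ arctan(arsinh(σ/δ)) dσ`, packaged -/

/-- **The Fisher profile.** For `δ > 0` and `S₀` there is a `C²` profile `F` with derivatives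
`F'`, `F''` (`F''` continuous) such that on `s ≥ 0`: `0 ≤ F(s) ≤ (π/2) s` and
`0 ≤ s F'(s) - F(s) ≤ (π/2) s`; `F'' > 0` everywhere; and `1/F''(s) ≤ (1 + arsinh²(S₀/δ))(s + δ)`
for `0 ≤ s ≤ S₀`. (Take `F' = arctan ∘ arsinh (·/δ)`: a bounded increasing slope whose curvature
`F''(s) = [(1 + arsinh²(s/δ)) δ√(1 + (s/δ)²)]⁻¹` decays only like `1/((s+δ) log²)`.) [folklore] -/
theorem exists_fisherProfile {δ : ℝ} (hδ : 0 < δ) (S₀ : ℝ) :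
    ∃ F F' F'' : ℝ → ℝ, (∀ u, HasDerivAt F (F' u) u) ∧ (∀ u, HasDerivAt F' (F'' u) u) ∧ Continuous F'' ∧
      (∀ s, 0 ≤ s → 0 ≤ F s ∧ F s ≤ Real.pi / 2 * s ∧ 0 ≤ s * F' s - F s ∧ s * F' s - F s ≤ Real.pi / 2 * s) ∧
      (∀ s, 0 < F'' s) ∧
      ∀ s, 0 ≤ s → s ≤ S₀ → 1 / F'' s ≤ (1 + Real.arsinh (S₀ / δ) ^ 2) * (s + δ) := by
  set F' : ℝ → ℝ := fun s => Real.arctan (Real.arsinh (s / δ)) with hF'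
  set F : ℝ → ℝ := fun s => ∫ σ in (0:ℝ)..s, F' σ with hF
  set F'' : ℝ → ℝ := fun s => 1 / (1 + Real.arsinh (s / δ) ^ 2) * ((Real.sqrt (1 + (s / δ) ^ 2))⁻¹ * (1 / δ))
    with hF''
  have hF'c : Continuous F' := Real.continuous_arctan.comp (Real.continuous_arsinh.comp (continuous_id.div_const δ))
  have hdF : ∀ u, HasDerivAt F (F' u) u := fun u => (hF'c.integral_hasStrictDerivAt 0 u).hasDerivAt
  have hdF' : ∀ u, HasDerivAt F' (F'' u) u := fun s => by
    have h1 : HasDerivAt (fun s : ℝ => s / δ) (1 / δ) s := by simpa using (hasDerivAt_id s).div_const δ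
    have h2 := (Real.hasDerivAt_arsinh (s / δ)).comp s h1
    have h3 := (Real.hasDerivAt_arctan (Real.arsinh (s / δ))).comp s h2
    exact h3
  have hF''c : Continuous F'' := by
    refine Continuous.mul ?_ ((Continuous.inv₀ ?_ fun s => ?_).mul continuous_const)
    · refine continuous_const.div (continuous_const.add ((Real.continuous_arsinh.comp
        (continuous_id.div_const δ)).pow 2)) fun s => ?_
      positivity
    · exact Real.continuous_sqrt.comp (continuous_const.add ((continuous_id.div_const δ).pow 2))
    · exact (Real.sqrt_pos.2 (by positivity)).ne'
  have hpos : ∀ s, 0 < F'' s := fun s => by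
    have h1 : 0 < Real.sqrt (1 + (s / δ) ^ 2) := Real.sqrt_pos.2 (by positivity)
    simp only [hF'']
    positivity
  have hmono : Monotone F' := fun _ _ h =>
    Real.arctan_mono (Real.arsinh_le_arsinh.2 (div_le_div_of_nonneg_right h hδ.le))
  have hslope : ∀ {s : ℝ}, 0 ≤ s → F' s ∈ Icc (0 : ℝ) (Real.pi / 2) := fun {s} hs =>
    ⟨Real.arctan_nonneg.2 (Real.arsinh_nonneg_iff.2 (div_nonneg hs hδ.le)), (Real.arctan_lt_pi_div_two _).le⟩
  have hbounds : ∀ s, 0 ≤ s → 0 ≤ F s ∧ F s ≤ Real.pi / 2 * s ∧ 0 ≤ s * F' s - F s ∧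
      s * F' s - F s ≤ Real.pi / 2 * s := by
    intro s hs
    have hint : IntervalIntegrable F' volume 0 s := hF'c.intervalIntegrable _ _
    have h0 : 0 ≤ F s := intervalIntegral.integral_nonneg hs fun σ hσ => (hslope hσ.1).1
    have h1 : F s ≤ ∫ _ in (0:ℝ)..s, Real.pi / 2 :=
      intervalIntegral.integral_mono_on hs hint intervalIntegrable_const fun σ hσ => (hslope hσ.1).2
    have h3 : F s ≤ ∫ _ in (0:ℝ)..s, F' s :=
      intervalIntegral.integral_mono_on hs hint intervalIntegrable_const fun σ hσ => hmono hσ.2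
    have h5 : ∫ _ in (0:ℝ)..s, (0 : ℝ) ≤ F s :=
      intervalIntegral.integral_mono_on hs intervalIntegrable_const hint fun σ hσ => (hslope hσ.1).1
    rw [intervalIntegral.integral_const, smul_eq_mul, sub_zero] at h1 h3 h5
    have h4 := hslope hs
    refine ⟨h0, by linarith, by linarith, ?_⟩
    nlinarith [h4.1, h4.2, h5]
  have hinv : ∀ s, 0 ≤ s → s ≤ S₀ → 1 / F'' s ≤ (1 + Real.arsinh (S₀ / δ) ^ 2) * (s + δ) := by
    intro s hs hsS
    have hsq : Real.sqrt (1 + (s / δ) ^ 2) ≤ (s + δ) / δ := by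
      refine Real.sqrt_le_iff.2 ⟨by positivity, ?_⟩
      have e : (s + δ) / δ = s / δ + 1 := by field_simp
      rw [e]
      nlinarith [div_nonneg hs hδ.le]
    have ha0 : 0 ≤ Real.arsinh (s / δ) := Real.arsinh_nonneg_iff.2 (div_nonneg hs hδ.le)
    have ha : Real.arsinh (s / δ) ≤ Real.arsinh (S₀ / δ) :=
      Real.arsinh_le_arsinh.2 (div_le_div_of_nonneg_right hsS hδ.le)
    have ha2 : Real.arsinh (s / δ) ^ 2 ≤ Real.arsinh (S₀ / δ) ^ 2 := pow_le_pow_left₀ ha0 ha 2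
    have hsq0 : 0 < Real.sqrt (1 + (s / δ) ^ 2) := Real.sqrt_pos.2 (by positivity)
    have e : 1 / F'' s = (1 + Real.arsinh (s / δ) ^ 2) * (Real.sqrt (1 + (s / δ) ^ 2) * δ) := by
      simp only [hF'']
      field_simp
    rw [e]
    have hb : Real.sqrt (1 + (s / δ) ^ 2) * δ ≤ s + δ := by
      have := mul_le_mul_of_nonneg_right hsq hδ.le
      rwa [div_mul_cancel₀ _ hδ.ne'] at this
    exact mul_le_mul (by linarith) hb (by positivity) (by positivity)
  exact ⟨F, F', F'', hdF, hdF', hF''c, hbounds, hpos, hinv⟩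

/-- **AM–GM with a curvature weight**: if `c > 0` and `1/c ≤ K` then for every `ε > 0` and `y`,
`|y| ≤ ½ (ε K + c y²/ε)`. [folklore] -/
theorem abs_le_amgm_of_inv_le {c K ε : ℝ} (hc : 0 < c) (hK : 1 / c ≤ K) (hε : 0 < ε) (y : ℝ) :
    |y| ≤ (ε * K + c * y ^ 2 / ε) / 2 := by
  set u := ε / c with hu
  have hu0 : 0 < u := div_pos hε hc
  have hamgm : 2 * |y| ≤ u + y ^ 2 / u := by
    rw [← sub_nonneg]
    have e : u + y ^ 2 / u - 2 * |y| = (u - |y|) ^ 2 / u := by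
      field_simp
      rw [← sq_abs y]; ring
    rw [e]; positivity
  have hu1 : u ≤ ε * K := by
    rw [hu, div_eq_mul_one_div]
    exact mul_le_mul_of_nonneg_left hK hε.le
  have hu2 : y ^ 2 / u = c * y ^ 2 / ε := by
    rw [hu]; field_simp
  rw [hu2] at hamgm
  linarith

/-! ### Continuity and support of carré-du-champ terms -/

section CarreDuChamp

variable {E : Type*} [NormedAddCommGroup E] [NormedSpace ℝ E]

/-- `Γ(f, g)` is continuous for `C²` functions `f, g` on a normed space. [folklore] -/
theorem continuous_carreDuChamp_of_contDiff (v₁ v₂ : E) {f g : E → ℝ} (hf : ContDiff ℝ 2 f)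
    (hg : ContDiff ℝ 2 g) : Continuous (carreDuChamp v₁ v₂ f g) := by
  have hfc : Continuous (fderiv ℝ f) := hf.continuous_fderiv (by norm_num)
  have hgc : Continuous (fderiv ℝ g) := hg.continuous_fderiv (by norm_num)
  rw [show carreDuChamp v₁ v₂ f g = _ from funext fun y => carreDuChamp_def v₁ v₂ f g y]
  exact ((hfc.clm_apply continuous_const).mul (hgc.clm_apply continuous_const)).add
    ((hfc.clm_apply continuous_const).mul (hgc.clm_apply continuous_const))

/-- `Γ(f, g)` has compact support if `f` has (any normed space). [folklore] -/
theorem hasCompactSupport_carreDuChamp_left (v₁ v₂ : E) {f : E → ℝ} (hfc : HasCompactSupport f)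
    (g : E → ℝ) : HasCompactSupport (carreDuChamp v₁ v₂ f g) := by
  rw [show carreDuChamp v₁ v₂ f g = _ from funext fun y => carreDuChamp_def v₁ v₂ f g y]
  exact ((hfc.fderiv_apply (𝕜 := ℝ) v₁).mul_right).add ((hfc.fderiv_apply (𝕜 := ℝ) v₂).mul_right)

end CarreDuChamp

end Literature.MathematicalPhysics.KineticTheory.HeatConduction
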